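import Literature.Analysis.FluidPDE.DuchonRobertInviscidLimit
import HarnessLib

/-!
# Strong inviscid limits of Leray–Hopf solutions are weak Euler solutions: discharge of `weakLimit_isWeakEuler_of_strong`

Analysis/FluidPDE proof file; sibling of `DuchonRobert` (the named fact
`Literature.Analysis.FluidPDE.weakLimit_isWeakEuler_of_strong`, turb.S20: DiPerna–Majda 1987, §1,
Prop. 1.1 ff.; Buckmaster–Vicol 2019, §8 — if unforced Leray–Hopf solutions `u_m` with
`ν_m → 0` converge to `u` weak-* in `L^∞_t L²_x` and strongly in `L²((0,T) × T^d)`, then `u` is a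
weak Euler solution) and of `DuchonRobertInviscidLimit`, whose hypothesis-minimal twin
`Torus.isWeakEulerSolutionOn_of_inviscidLimit` (proved there: pressure-free weak solutions,
`u ∈ L²_{t,x}`, strong `L²` convergence) does all the work. This file PROVES the fact
(`weakLimit_isWeakEuler_of_strong_holds`): Leray–Hopf solutions are pressure-free weak solutions on
`(0,T)` (`Torus.IsLerayHopfOn.isWeakNSSolutionWithDataOn`), and the limit is in `L²_{t,x}` because
the sequence is bounded in `L^∞_t L²_x` (the first clause of `Torus.TendstoWeakStar`) and converges
to `u` in `L²_{t,x}`.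

## References

* R. J. DiPerna, A. J. Majda, *Oscillations and concentrations in weak solutions of the
  incompressible fluid equations*, Comm. Math. Phys. 108 (1987), §1, Prop. 1.1 ff. [DiPernaMajda1987]
* T. D. Drivas, G. L. Eyink, *An Onsager singularity theorem for Leray solutions of incompressible
  Navier–Stokes*, Nonlinearity 32 (2019) = arXiv:1710.05205, Thm. 2(ii) and its proof. [DrivasEyink2019]
-/

noncomputable section

open MeasureTheory Set Filter Topology Function
open scoped ENNReal NNReal

namespace Literature.Analysis.FluidPDE

variable {d : Type*} [Fintype d] [DecidableEq d] {T : ℝ} {νseq : ℕ → ℝ}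
  {useq : ℕ → ℝ → UnitAddTorus d → EuclideanSpace ℝ d}
  {u₀seq : ℕ → UnitAddTorus d → EuclideanSpace ℝ d} {u : ℝ → UnitAddTorus d → EuclideanSpace ℝ d}

omit [DecidableEq d] in
/-- **A strong `L²_{t,x}` limit of a sequence bounded in `L^∞_t L²_x` is in `L²_{t,x}`**:
`∫₀ᵀ∫ |u|² ≤ 2∫₀ᵀ∫ |u_m - u|² + 2CT < ∞` for `m` large. [folklore] -/
theorem lintegral_enorm_sq_lt_top_of_tendsto
    (hbound : ∃ C : ℝ≥0, ∀ m, ∀ᵐ t ∂(volume.restrict (Ioo 0 T)), ∫⁻ x, ‖useq m t x‖ₑ ^ 2 ≤ C)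
    (hWm : ∀ m, AEStronglyMeasurable (uncurry (useq m)) ((volume.restrict (Ioo 0 T)).prod volume))
    (hum : AEStronglyMeasurable (uncurry u) ((volume.restrict (Ioo 0 T)).prod volume))
    (hstrong : Tendsto (fun m => ∫⁻ t in Ioo 0 T, ∫⁻ x, ‖useq m t x - u t x‖ₑ ^ 2) atTop (𝓝 0)) :
    ∫⁻ t in Ioo 0 T, ∫⁻ x, ‖u t x‖ₑ ^ 2 < ∞ := by
  obtain ⟨C, hC⟩ := hbound
  obtain ⟨m, hm⟩ := (hstrong.eventually (gt_mem_nhds (show (0 : ℝ≥0∞) < 1 by norm_num))).exists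
  set μT := (volume.restrict (Ioo 0 T)).prod (volume : Measure (UnitAddTorus d)) with hμT
  -- pointwise: `|u|² ≤ 2|u_m - u|² + 2|u_m|²`
  have hpt : ∀ t x, ‖u t x‖ₑ ^ 2 ≤ 2 * ‖useq m t x - u t x‖ₑ ^ 2 + 2 * ‖useq m t x‖ₑ ^ 2 := by
    intro t x
    have h1 : ‖u t x‖ₑ ≤ ‖useq m t x - u t x‖ₑ + ‖useq m t x‖ₑ := by
      have h := enorm_sub_le (E := EuclideanSpace ℝ d) (a := useq m t x) (b := useq m t x - u t x)
      rwa [sub_sub_cancel, add_comm] at h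
    -- `(a + b)² ≤ 2a² + 2b²` in `ℝ≥0∞` (as `ennreal_add_sq_le` in `DistributionalToWeak`)
    have h2 : ∀ a b : ℝ≥0∞, (a + b) ^ 2 ≤ 2 * a ^ 2 + 2 * b ^ 2 := fun a b => by
      have h := ENNReal.rpow_add_le_mul_rpow_add_rpow a b (p := 2) one_le_two
      norm_num [ENNReal.rpow_two] at h
      simpa [mul_add] using h
    exact (pow_le_pow_left' h1 2).trans (h2 _ _)
  -- the two bounds
  have hA : ∫⁻ t in Ioo 0 T, ∫⁻ x, 2 * ‖useq m t x - u t x‖ₑ ^ 2 < ∞ := by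
    have e : ∫⁻ t in Ioo 0 T, ∫⁻ x, 2 * ‖useq m t x - u t x‖ₑ ^ 2 =
        2 * ∫⁻ t in Ioo 0 T, ∫⁻ x, ‖useq m t x - u t x‖ₑ ^ 2 := by
      rw [← lintegral_const_mul' _ _ ENNReal.ofNat_ne_top]
      refine lintegral_congr fun t => ?_
      rw [lintegral_const_mul' _ _ ENNReal.ofNat_ne_top]
    rw [e]
    exact ENNReal.mul_lt_top ENNReal.ofNat_lt_top (hm.trans ENNReal.one_lt_top)
  have hB : ∫⁻ t in Ioo 0 T, ∫⁻ x, 2 * ‖useq m t x‖ₑ ^ 2 < ∞ := by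
    have h1 : ∫⁻ t in Ioo 0 T, ∫⁻ x, 2 * ‖useq m t x‖ₑ ^ 2 ≤ ∫⁻ _ in Ioo 0 T, 2 * (C : ℝ≥0∞) := by
      refine lintegral_mono_ae ((hC m).mono fun t ht => ?_)
      rw [lintegral_const_mul' _ _ ENNReal.ofNat_ne_top]
      exact mul_le_mul_right ht 2
    refine lt_of_le_of_lt h1 ?_
    rw [lintegral_const, Measure.restrict_apply_univ]
    exact ENNReal.mul_lt_top (ENNReal.mul_lt_top ENNReal.ofNat_lt_top ENNReal.coe_lt_top) measure_Ioo_lt_top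
  -- measurability of the two summands, to split the integral
  have hmA : AEMeasurable (uncurry fun t x => 2 * ‖useq m t x - u t x‖ₑ ^ 2) μT :=
    (((hWm m).sub hum).enorm.pow_const 2).const_mul 2
  have hmB : AEMeasurable (uncurry fun t x => 2 * ‖useq m t x‖ₑ ^ 2) μT :=
    ((hWm m).enorm.pow_const 2).const_mul 2
  calc ∫⁻ t in Ioo 0 T, ∫⁻ x, ‖u t x‖ₑ ^ 2
      ≤ ∫⁻ t in Ioo 0 T, ∫⁻ x, (2 * ‖useq m t x - u t x‖ₑ ^ 2 + 2 * ‖useq m t x‖ₑ ^ 2) :=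
        lintegral_mono fun t => lintegral_mono fun x => hpt t x
    _ = ∫⁻ z, (2 * ‖useq m z.1 z.2 - u z.1 z.2‖ₑ ^ 2 + 2 * ‖useq m z.1 z.2‖ₑ ^ 2) ∂μT :=
        Torus.lintegral_Ioo_lintegral_eq_lintegral_prod (hmA.add hmB)
    _ = ∫⁻ z, 2 * ‖useq m z.1 z.2 - u z.1 z.2‖ₑ ^ 2 ∂μT + ∫⁻ z, 2 * ‖useq m z.1 z.2‖ₑ ^ 2 ∂μT :=
        lintegral_add_left' hmA _
    _ = (∫⁻ t in Ioo 0 T, ∫⁻ x, 2 * ‖useq m t x - u t x‖ₑ ^ 2) + ∫⁻ t in Ioo 0 T, ∫⁻ x, 2 * ‖useq m t x‖ₑ ^ 2 := by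
        rw [Torus.lintegral_Ioo_lintegral_eq_lintegral_prod hmA, Torus.lintegral_Ioo_lintegral_eq_lintegral_prod hmB]
    _ < ∞ := ENNReal.add_lt_top.2 ⟨hA, hB⟩

/-- **Discharge of `FluidPDE.weakLimit_isWeakEuler_of_strong`** (turb.S20; DiPerna–Majda 1987, §1,
Prop. 1.1 ff.): strong `L²((0,T) × T^d)` limits of unforced Leray–Hopf solutions with `ν_m → 0`
are weak Euler solutions — by `Torus.isWeakEulerSolutionOn_of_inviscidLimit`
(`DuchonRobertInviscidLimit`), Leray–Hopf solutions being pressure-free weak solutions on `(0,T)`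
and the limit lying in `L²_{t,x}` (`lintegral_enorm_sq_lt_top_of_tendsto`). The weak-* convergence
hypothesis is used only through its uniform `L^∞_t L²_x` bound. [cite: DiPernaMajda1987, §1 Prop. 1.1 ff.] -/
theorem weakLimit_isWeakEuler_of_strong_holds :
    weakLimit_isWeakEuler_of_strong (T := T) (νseq := νseq) (useq := useq) (u₀seq := u₀seq) (u := u) := by
  intro hν0 hLH hw hmeas hstrong
  have hW : ∀ m, FunctionSpaces.Torus.IsWeakNSSolutionOn T (νseq m) (useq m) := fun m =>
    (hLH m).isWeakNSSolutionWithDataOn.isWeakNSSolutionOn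
  have hWm : ∀ m, AEStronglyMeasurable (uncurry (useq m)) ((volume.restrict (Ioo 0 T)).prod volume) := fun m =>
    Torus.aestronglyMeasurable_uncurry_prod (hW m).1
  have hum : AEStronglyMeasurable (uncurry u) ((volume.restrict (Ioo 0 T)).prod volume) :=
    Torus.aestronglyMeasurable_uncurry_prod hmeas
  have hu2 : ∫⁻ t in Ioo 0 T, ∫⁻ x, ‖u t x‖ₑ ^ 2 < ∞ :=
    lintegral_enorm_sq_lt_top_of_tendsto hw.1 hWm hum hstrong
  exact Torus.isWeakEulerSolutionOn_of_inviscidLimit hν0 (Eventually.of_forall hW) hmeas hu2 hstrong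

end Literature.Analysis.FluidPDE
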